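import Literature.AlgebraicGeometry.RelativeSpec.TorsorQuotientModuleDescent
import Literature.AlgebraicGeometry.RelativeSpec.TorsorQuotientModuleChartProjective
import Literature.AlgebraicGeometry.RelativeSpec.TorsorQuotientModuleChartCocycle
import Literature.AlgebraicGeometry.GroupSchemes.ActionTripleSquare
import Literature.AlgebraicGeometry.Modules.SchemeLinearisation
import HarnessLib

/-!
# Descent of a LINEARISED vector bundle along a torsor quotient by a group scheme — the wave-C junction, generic half
# ([SGA1] Exp. VIII Thm. 1.1 ∕ Prop. 1.10; [MumfordAV1970] §12 Thm. 1 (B) p. 112; [MumfordFogartyKirwan1994] Ch. 1 §3 Def. 1.6)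

Topic `Literature/AlgebraicGeometry/RelativeSpec`; namespace `Literature.AlgebraicGeometry.RelativeSpec.TorsorQuotient`.  THEOREMS ONLY (no
definition, no named fact, no instance, no notation, no `sorry`).

THE PRINT.  [SGA1] Exp. VIII Thm. 1.1: quasi-coherent modules descend effectively along a faithfully flat quasi-compact morphism; Prop. 1.10:
so does local freeness of a given rank.  [MumfordAV1970] §12 Thm. 1 (B) (p. 112) ∕ [MumfordFogartyKirwan1994] Ch. 1 §3 Def. 1.6 (p. 30) + Prop.
7.1: for a `G`-TORSOR `π : X → Q` the descent datum of a module `E` on `X` is a `G`-LINEARISATION of `E` — an isomorphism `σ^*E ≅ p₂^*E` on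
`G × X` with the unit and cocycle identities — and `E ≅ π^*P` for an essentially unique `P` on `Q`; if `E` is locally free of rank `r`, so is `P`.

THIS FILE is the ASSEMBLY, in Mathlib's cartesian-monoidal `Over S` currency (`[GrpObj G] [ModObj G X]`, action `γ[G, X]`), of the organs typed
for the wave-C line of cell `hodgecm-mathlib` (§D `F0P6bMumfordDualFlat.stub_L4B1uD_mumfordLambdaDescent` of `Cruxes/HLiu418/Lines/F0_P6b_MumfordDualFlat.lean`,
desk F0P6b-plan (g14) MEMO-SD-LINE v1) — each consumed BY NAME, nothing restated:
* ★ (i) `RelativeSpec/SchemeEquivariantModuleInvariants` («LH5» LH5-p04): the coinvariant subsheaf `moduleCoinvariants π E hw Φ ⊆ π_*E`, `descentHom`;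
* ★ (ii) PART 2 `RelativeSpec/TorsorQuotientModuleChartCocycle` (F0P2-p01, over PART 1 «L2» LA2-p02, s20 LH5-p04, (ii)-alg F0P3a-p06):
  `isBaseChange_of_range_eq_equaliser` — on an affine chart `V` the equaliser of the two cofaces is a base change of `Γ(π⁻¹V, E)`, from the
  torsor square, the affine TRIPLE square and the cocycle ∕ unit identities in `squareIso` dress;
* ★ `GroupSchemes/ActionTripleSquare` («LH6» LH6-p03, s19): the triple square `(G ◁ γ, pr₂) : G × G × X ⇉ G × X` over `(pr₂, γ)`;
* ★ (iii) `RelativeSpec/TorsorQuotientModuleDescent` («LH5» LH5-p02): `descentHom_app_bijective_of_isBaseChange`, `exists_descent_of_hasRank`;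
* ★ `RelativeSpec/TorsorQuotientModuleChartProjective` («LH10» LH10-p01, over ★ (E4) `RingTheory/Flat/FiniteProjectiveDescent`, B-p04):
  `finite_projective_of_isBaseChange_chart_of_isAffineHom`;
* ★ Dβ-def `Modules/SchemeLinearisation` («LH6» LH6-p01): `structure Linearisation` (`iso`, `iso_unit_hom`, `iso_mul_hom`), `unitSlice`, `actRight`, `proj₂₃`
  and their face identities.

Statements (junction hand Dδ, F0P3a-p09 (g26)):
* §1 `isPullback_actRight_proj₂₃_left` — the triple square in Def.-1.6 dress: `IsPullback (actRight G X).left (proj₂₃ G X).left pr₂.left γ.left`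
  (★ s19 precomposed with the associator);
* §2 **`exists_isBaseChange_moduleCoinvariantsι_app`** — for `π` flat surjective affine with torsor square `hsq` and a LINEARISATION `Λ` of a
  quasi-coherent `E`: over every affine `V ⊆ Q` the inclusion `ι.app V : Γ(V, (π_*E)^G) → Γ(π⁻¹V, E)`, read `Γ(V)`-linear, is a BASE CHANGE
  `Γ(π⁻¹V) ⊗_{Γ(V)} Γ(V, (π_*E)^G) ≅ Γ(π⁻¹V, E)` (PART 2's chart theorem at `e₁₂ := actRight`, `e₁₃ := μ ▷ X`, `e₂₃ := proj₂₃`, `u := unitSlice`,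
  `hcoc := Λ.iso_mul_hom`, `hunit := Λ.iso_unit_hom`; the linear map is `ι.app V` itself — Mathlib's pushforward restricts scalars along
  `π.app V = π.appLE V (π⁻¹V) le_rfl`);
* §3 `descentHom_app_bijective_of_linearisation`, `finite_projective_moduleCoinvariants_of_linearisation` — hence (iii)'s `hbij` and `hproj`;
* §4 **`exists_descent_of_linearisation`** — THE HEAD: `E` of rank `r` with a linearisation along a torsor quotient `π` (affine, flat, surjective;
  `pr₂ : G × X → X` affine) is `π^*P` for some `P` of rank `r` on `Q` ([SGA1] VIII 1.1 + 1.10 for `G`-torsors).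

Cell `hodgecm-mathlib` (D-0151), `--supports stmt-HodgeConjecture-24832`; count-neutral; HC_CM is proved only modulo the printed citations (2 remaining
named inputs hLiu418 = `stmt-HodgeConjecture-24832`, h413 = `stmt-HodgeConjecture-24833`) until rung 0 closes; nothing here is about HC.

## References
* [SGA1] A. Grothendieck, *SGA 1*, Exp. VIII §1, Thm. 1.1 and Prop. 1.10.
* [MumfordAV1970] D. Mumford, *Abelian Varieties* (1970), §12 Thm. 1 (B) (p. 112).
* [MumfordFogartyKirwan1994] D. Mumford, J. Fogarty, F. Kirwan, *GIT* 3rd ed. (1994), Ch. 1 §3 Def. 1.6 (p. 30); Ch. 7 §1 Prop. 7.1.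
* [StacksProject] The Stacks Project, Tag 023N (descent for modules), Tag 05B2 (finite locally free descends).
-/

noncomputable section

set_option autoImplicit false

-- `Scheme.Modules` / `SheafOfModules` are not reducible (as in ★ (i)–(iii)).
set_option backward.isDefEq.respectTransparency false

universe u

open CategoryTheory CategoryTheory.Limits AlgebraicGeometry MonoidalCategory CartesianMonoidalCategory TopologicalSpace Opposite
open Literature.AlgebraicGeometry.Modules Literature.AlgebraicGeometry.Motives
open scoped MonObj

namespace Literature.AlgebraicGeometry.RelativeSpec.TorsorQuotient

open Literature.AlgebraicGeometry.GroupSchemes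

variable {S : Scheme.{u}} {G X Q : Over S} [GrpObj G] [ModObj G X] (π : X ⟶ Q) (E : X.left.Modules)
  (hw : γ[G, X] ≫ π = snd G X ≫ π) (Λ : Linearisation G X E)

/-! ## §1 The triple square in the dress of [MumfordFogartyKirwan1994] Def. 1.6 -/

/-- **The affine TRIPLE square** `((G ⊗ G) ⊗ X ; 1 × σ, p₂₃)` over `(p₂, σ)`: `IsPullback (actRight G X).left (proj₂₃ G X).left (snd G X).left (γ[G, X]).left`
— ★ `ActionTripleSquare.Over.isPullback_whiskerLeft_smul_snd_left` precomposed with the associator `(G ⊗ G) ⊗ X ≅ G ⊗ (G ⊗ X)`.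
[cite: SGA1, Exp. V §1] [cite: MumfordFogartyKirwan1994, Ch. 1 §3 Def. 1.6 (p. 30)] -/
theorem isPullback_actRight_proj₂₃_left :
    IsPullback (actRight G X).left (proj₂₃ G X).left (snd G X).left (γ[G, X]).left := by
  have h := ActionTripleSquare.Over.isPullback_whiskerLeft_smul_snd_left G X
  have e₁ : (actRight G X).left = (α_ G G X).hom.left ≫ (G ◁ γ[G, X]).left := by rw [← Over.comp_left]; rfl
  have e₂ : (proj₂₃ G X).left = (α_ G G X).hom.left ≫ (snd G (G ⊗ X)).left := by rw [← Over.comp_left]; rfl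
  rw [e₁, e₂]
  exact IsPullback.of_iso h ((Over.forget _).mapIso (α_ G G X)).symm (Iso.refl _) (Iso.refl _) (Iso.refl _)
    (by simp [← Over.comp_left]) (by simp) (by simp) (by simp)

/-! ## §2 Per affine chart: the coinvariant inclusion is a base change (PART 2's chart theorem fed with the linearisation) -/

set_option maxHeartbeats 400000 in -- one application of ★ PART 2's 23-hypothesis chart head at `(actRight, μ ▷ X, proj₂₃)` (2× default, = ★ PART 2 §6's own budget)
/-- **THE COINVARIANT INCLUSION IS A BASE CHANGE ON EVERY AFFINE CHART.**  `π : X → Q` flat, surjective, with torsor square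
`hsq : IsPullback σ.left p₂.left π.left π.left`; `E` quasi-coherent with a LINEARISATION `Λ`; `V ⊆ Q` affine with `π⁻¹V` affine.  Then the inclusion
`ι.app V : Γ(V, (π_*E)^G) ↪ Γ(π⁻¹V, E)` — `Γ(V)`-linear for the structure restricted along `π^♯ = π.appLE V (π⁻¹V)` — exhibits `Γ(π⁻¹V, E)` as the
BASE CHANGE `Γ(π⁻¹V) ⊗_{Γ(V)} Γ(V, (π_*E)^G)`: ★ PART 2 `isBaseChange_of_range_eq_equaliser` at `(e₁₂, e₁₃, e₂₃) := (actRight, μ ▷ X, proj₂₃)`,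
`(act, pr₂) := (σ, p₂)`, with §1, the three face identities, `Λ.iso_mul_hom` (cocycle), `unitSlice` + `Λ.iso_unit_hom` (unit), injectivity of `ι.app V`
(★ (i)) and the intersection form of coinvariance (★ (iii) §0). [cite: SGA1, Exp. VIII §1, Thm. 1.1] [cite: MumfordAV1970, §12 Theorem 1 (B) (p. 112)]
[cite: MumfordFogartyKirwan1994, Ch. 1 §3 Def. 1.6 (p. 30)] -/
theorem exists_isBaseChange_moduleCoinvariantsι_app [Flat π.left] [Surjective π.left] [E.IsQuasicoherent]
    (hsq : IsPullback (γ[G, X]).left (snd G X).left π.left π.left) {V : Q.left.Opens} (hV : IsAffineOpen V)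
    (hU : IsAffineOpen (π.left ⁻¹ᵁ V)) :
    ∃ (j : letI : Module Γ(Q.left, V) Γ(E, π.left ⁻¹ᵁ V) := Module.compHom _ (π.left.appLE V (π.left ⁻¹ᵁ V) le_rfl).hom
        Γ(SchemeEquivariant.moduleCoinvariants π E hw Λ.iso.hom, V) →ₗ[Γ(Q.left, V)] Γ(E, π.left ⁻¹ᵁ V)),
      (∀ y, j y = (SchemeEquivariant.moduleCoinvariantsι π E hw Λ.iso.hom).app V y) ∧
      (letI := (π.left.appLE V (π.left ⁻¹ᵁ V) le_rfl).hom.toAlgebra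
      letI : Module Γ(Q.left, V) Γ(E, π.left ⁻¹ᵁ V) := Module.compHom _ (π.left.appLE V (π.left ⁻¹ᵁ V) le_rfl).hom
      haveI : IsScalarTower Γ(Q.left, V) Γ(X.left, π.left ⁻¹ᵁ V) Γ(E, π.left ⁻¹ᵁ V) :=
        ⟨fun a b x => mul_smul ((π.left.appLE V (π.left ⁻¹ᵁ V) le_rfl).hom a) b x⟩
      IsBaseChange Γ(X.left, π.left ⁻¹ᵁ V) j) := by
  letI : Module Γ(Q.left, V) Γ(E, π.left ⁻¹ᵁ V) := Module.compHom _ (π.left.appLE V (π.left ⁻¹ᵁ V) le_rfl).hom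
  -- the native `Γ(π⁻¹V, 𝒪)`-module structure, registered on the (definitionally equal) pushforward-sections type
  letI : Module Γ(X.left, π.left ⁻¹ᵁ V) Γ((Scheme.Modules.pushforward π.left).obj E, V) :=
    inferInstanceAs (Module Γ(X.left, π.left ⁻¹ᵁ V) Γ(E, π.left ⁻¹ᵁ V))
  -- `ι.app V` is `Γ(V)`-linear for the `appLE`-restricted structure (Mathlib's pushforward restricts along `π.app V = π.appLE V _ le_rfl`)
  have hsmul : ∀ (a : Γ(Q.left, V)) (y : Γ(SchemeEquivariant.moduleCoinvariants π E hw Λ.iso.hom, V)),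
      (SchemeEquivariant.moduleCoinvariantsι π E hw Λ.iso.hom).app V (a • y) =
        a • (show Γ(E, π.left ⁻¹ᵁ V) from (SchemeEquivariant.moduleCoinvariantsι π E hw Λ.iso.hom).app V y) := by
    intro a y
    rw [Scheme.Modules.Hom.app_smul]
    show (π.left.app V a) • (SchemeEquivariant.moduleCoinvariantsι π E hw Λ.iso.hom).app V y =
      (π.left.appLE V (π.left ⁻¹ᵁ V) le_rfl a) • (SchemeEquivariant.moduleCoinvariantsι π E hw Λ.iso.hom).app V y
    rw [Scheme.Hom.appLE_eq_app]
  let j : Γ(SchemeEquivariant.moduleCoinvariants π E hw Λ.iso.hom, V) →ₗ[Γ(Q.left, V)] Γ(E, π.left ⁻¹ᵁ V) :=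
    { toFun := fun y => (SchemeEquivariant.moduleCoinvariantsι π E hw Λ.iso.hom).app V y
      map_add' := fun y y' => map_add _ y y'
      map_smul' := hsmul }
  -- feed PART 2 hypotheses typed LITERALLY over `⇑j` (so its 23-binder head unifies syntactically, inside the default budget)
  have hcoe : (⇑j : Γ(SchemeEquivariant.moduleCoinvariants π E hw Λ.iso.hom, V) → Γ(E, π.left ⁻¹ᵁ V)) =
      ⇑((SchemeEquivariant.moduleCoinvariantsι π E hw Λ.iso.hom).app V) := rfl
  have hjinj : Function.Injective j := by
    rw [hcoe]; exact SchemeEquivariant.moduleCoinvariantsι_app_injective π E hw Λ.iso.hom V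
  have hj : ∀ s : Γ(E, π.left ⁻¹ᵁ V), s ∈ Set.range j ↔
      ((Scheme.Modules.pullback (snd G X).left).obj E).presheaf.map
          (homOfLE (inf_le_left : (γ[G, X]).left ⁻¹ᵁ (π.left ⁻¹ᵁ V) ⊓ (snd G X).left ⁻¹ᵁ (π.left ⁻¹ᵁ V) ≤
            (γ[G, X]).left ⁻¹ᵁ (π.left ⁻¹ᵁ V))).op
          (Λ.iso.hom.app ((γ[G, X]).left ⁻¹ᵁ (π.left ⁻¹ᵁ V)) (unitSection (γ[G, X]).left E (π.left ⁻¹ᵁ V) s)) =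
        ((Scheme.Modules.pullback (snd G X).left).obj E).presheaf.map
          (homOfLE (inf_le_right : (γ[G, X]).left ⁻¹ᵁ (π.left ⁻¹ᵁ V) ⊓ (snd G X).left ⁻¹ᵁ (π.left ⁻¹ᵁ V) ≤
            (snd G X).left ⁻¹ᵁ (π.left ⁻¹ᵁ V))).op
          (unitSection (snd G X).left E (π.left ⁻¹ᵁ V) s) := by
    rw [hcoe]; exact SchemeEquivariant.mem_range_moduleCoinvariantsι_app_iff_inf π E hw Λ.iso.hom V
  refine ⟨j, fun y => rfl, ?_⟩
  exact isBaseChange_of_range_eq_equaliser (P₃ := (G ⊗ G) ⊗ X) (P := G ⊗ X) (O := X) (Q := Q) (V := V)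
    (actRight G X) (μ[G] ▷ X) (proj₂₃ G X) γ[G, X] (snd G X) π E Λ.iso.hom hsq
    (isPullback_actRight_proj₂₃_left (G := G) (X := X)) _ _ _
    Λ.iso_mul_hom (unitSlice G X) _ _ Λ.iso_unit_hom hV hU j hjinj hj

/-! ## §3 Hence the comparison is chartwise bijective and the coinvariant sections are chartwise finite projective -/

/-- **`π^*(π_*E)^G ⟶ E` IS BIJECTIVE ON EVERY AFFINE CHART `π⁻¹V`** for a linearised quasi-coherent `E` along an affine flat surjective torsor
quotient (§2 + ★ (iii) §5 `descentHom_app_bijective_of_isBaseChange`). [cite: SGA1, Exp. VIII §1, Thm. 1.1] [cite: MumfordAV1970, §12 Theorem 1 (B) (p. 112)] -/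
theorem descentHom_app_bijective_of_linearisation [IsAffineHom π.left] [Flat π.left] [Surjective π.left] [IsAffineHom (snd G X).left]
    [E.IsQuasicoherent] (hsq : IsPullback (γ[G, X]).left (snd G X).left π.left π.left) (V : Q.left.Opens) (hV : IsAffineOpen V) :
    Function.Bijective ((SchemeEquivariant.descentHom π E hw Λ.iso.hom).app (π.left ⁻¹ᵁ V)) := by
  obtain ⟨j, hjι, hbc⟩ := exists_isBaseChange_moduleCoinvariantsι_app π E hw Λ hsq hV (hV.preimage π.left)
  exact SchemeEquivariant.descentHom_app_bijective_of_isBaseChange π E hw Λ.iso.hom (IsAffineLocalizing.of_isQuasicoherent E) hV j hjι hbc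

/-- **THE COINVARIANT SECTIONS OVER AN AFFINE CHART ARE FINITE PROJECTIVE** when `E` has rank `r` (§2 + ★ `finite_projective_of_isBaseChange_chart_of_isAffineHom`,
i.e. ★ (E4) «finite projective descends along faithfully flat»). [cite: SGA1, Exp. VIII Prop. 1.10] [cite: StacksProject, Tag 05B2] -/
theorem finite_projective_moduleCoinvariants_of_linearisation [IsAffineHom π.left] [Flat π.left] [Surjective π.left]
    (hsq : IsPullback (γ[G, X]).left (snd G X).left π.left π.left) {r : ℕ} (hE : HasRank E r) (V : Q.left.Opens) (hV : IsAffineOpen V) :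
    Module.Finite Γ(Q.left, V) Γ(SchemeEquivariant.moduleCoinvariants π E hw Λ.iso.hom, V) ∧
      Module.Projective Γ(Q.left, V) Γ(SchemeEquivariant.moduleCoinvariants π E hw Λ.iso.hom, V) := by
  haveI := (HasRank.isFiniteLocallyFree' hE).isVectorBundle.1
  obtain ⟨j, -, hbc⟩ := exists_isBaseChange_moduleCoinvariantsι_app π E hw Λ hsq hV (hV.preimage π.left)
  exact finite_projective_of_isBaseChange_chart_of_isAffineHom π.left E hE hV j hbc

/-! ## §4 The head: descent of a linearised vector bundle along a torsor quotient -/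

include hw Λ in
/-- **DESCENT OF A LINEARISED VECTOR BUNDLE ALONG A TORSOR QUOTIENT** ([SGA1] Exp. VIII Thm. 1.1 + Prop. 1.10; [MumfordAV1970] §12 Thm. 1 (B);
[MumfordFogartyKirwan1994] Def. 1.6 ∕ Prop. 7.1).  Let `G` be an `S`-group scheme acting on `X`, `π : X → Q` an `S`-morphism which is AFFINE, FLAT
and SURJECTIVE with `σ ≫ π = p₂ ≫ π` and the TORSOR SQUARE `G ×_S X ≅ X ×_Q X` (`hsq`), `pr₂ : G ×_S X → X` affine (e.g. `G → S` finite), and `E` a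
module on `X` of rank `r` with a `G`-LINEARISATION `Λ`.  Then `E ≅ π^*P` for some module `P` of rank `r` on `Q` (namely the coinvariant subsheaf
`(π_*E)^G`): ★ (iii) `exists_descent_of_hasRank` fed with §3. [cite: SGA1, Exp. VIII §1, Thm. 1.1] [cite: SGA1, Exp. VIII Prop. 1.10]
[cite: MumfordAV1970, §12 Theorem 1 (B) (p. 112)] [cite: MumfordFogartyKirwan1994, Ch. 1 §3 Def. 1.6 (p. 30)] -/
theorem exists_descent_of_linearisation [IsAffineHom π.left] [Flat π.left] [Surjective π.left] [IsAffineHom (snd G X).left]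
    (hsq : IsPullback (γ[G, X]).left (snd G X).left π.left π.left) {r : ℕ} (hE : HasRank E r) :
    ∃ P : Q.left.Modules, HasRank P r ∧ Nonempty ((Scheme.Modules.pullback π.left).obj P ≅ E) := by
  haveI := (HasRank.isFiniteLocallyFree' hE).isVectorBundle.1
  exact SchemeEquivariant.exists_descent_of_hasRank π E hw Λ.iso.hom
    (descentHom_app_bijective_of_linearisation π E hw Λ hsq)
    (finite_projective_moduleCoinvariants_of_linearisation π E hw Λ hsq hE) hE

end Literature.AlgebraicGeometry.RelativeSpec.TorsorQuotient

end
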